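import Mathlib
import HarnessLib
import Summits.HubbardSuperconductivity.HubbardSuperconductivity.Theorems.KLProgrammeKLRegimeSplitEdgeFactsWindowedMass
import Summits.HubbardSuperconductivity.HubbardSuperconductivity.Theorems.KLProgrammeKLRegimeWickScaleFlowRungs

/-!
# Route `KLProgramme` — ENGINE child gen 8 (stmt-HubbardSuperconductivity-20437 `KLRegimeEngineV17F2`), located item #19 «(c)-DRESSING-AVG» (plan g21 (R90)), input
# (W2-ρ): an explicit RUNG PROFILE `ρᵢ` for the member flows of the relative step, with its TOTAL and WINDOWED masses
# (cell gate-hubbard-kl, seat hubbard-kl-p1 g13, EdgeFacts lane)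

WHY.  The keyed relative step (`pairTransferRelAt_succ_keyed` p592121 / Ẽ-form `pairTransferRelRes_succ_keyed` p594243, k3c1-p1) runs the two members' rung curves
`bᵢ(t) = −B(φᵢ(t), φᵢ(t))` (`B = klBubbleMass … (K_{n+1})`, running symbol `φᵢ(t) = ψᵢ + (w_{Λ_{n+1}} − w_{Λ(t)})`, `Λ(t) = Λₙ + t(Λ_{n+1} − Λₙ)`) and asks the closer for
profiles `ρᵢ` with `‖bᵢ(t,c) − bᵢ(0,c)‖ ≤ ρᵢ(c)` on `[0,1]`; the four-term dressing then CONVOLVES the inherited bar with `ρᵢ` at EVERY step, so by item #19 the gain slots need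
the WINDOWED mass of `ρᵢ` (`Σ_{|c − x|_𝕋 ≤ η} ρᵢ(c) ≤ A·η`, consumed by `klam_relGain_angular_le`, p593991).  This file supplies an explicit, `t`-uniform profile and its masses:

* §1 (`klws_cutoffWeight_anti_scale`: the weight above scale is antitone in the scale), `klTorusNorm_le_pi`; the termwise MAJORANT of a bubble
  `klBubbleMaj a b Qm c := (βL²)⁻¹·Σ_ν (|a|‖ĝ‖)(ν,c)·(|b|‖ĝ‖)(ν̄, Qm − c)` (`abs_klBubbleMass_le`), monotone in `|a|, |b|`, with WINDOWED sums
  `sum_window_klBubbleMaj_le_of_left/_right` (hard line `≤ A` ⇒ `(βL²)⁻¹·A ×` the windowed soft sum of the partner, around `Qm − x` resp. `x`).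
* §2 **`klRungProfile β μ K n ψ Qm c := Maj(s, φ₀) + Maj(φ₀, s) + Maj(s, s)`**, `s = s^K_{n,n+1}`, `φ₀ = ψ + s` (the history member's symbol), and
  **`norm_rung_sub_rung_zero_le_klRungProfile`**: for `t ∈ [0,1]`, `‖b(t,c) − b(0,c)‖ ≤ klRungProfile … c` (bilinearity: `B(φ_t,φ_t) − B(φ₀,φ₀) = B(δ,φ₀) + B(φ₀,δ) + B(δ,δ)`,
  `|δ| = w_{Λ(t)} − w_{Λₙ} ≤ s`).
* §3 masses on an admissible frame (`FrameOK`, `klBetaMin ≤ β ≤ L`, `0 ≤ φ₀ ≤ 1 − w^K_{Λₙ}`): WINDOWED **`sum_window_klRungProfile_le`** `Σ_{c : |c − x|_𝕋 ≤ ρ} ρ(c) ≤ 369144·(ρ/π + 1/L)`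
  (hard line `s‖ĝ‖ ≤ 2/Λ_{n+1} = 8/Λₙ`, soft partners windowed by `sum_window_softSymbol_mul_norm_propCT_le`), TOTAL `sum_klRungProfile_le` (`≤ 738288`, the window `ρ = π`), the
  `A·η` shape `…_linear` (`π/L ≤ η`), and the INDEX forms for `ψ = s^K_{n+1,j}` (`φ₀ = s^K_{n,j}`, `softSymbolCompl_succ_add_slice`).
Everything is proved; two bookkeeping definitions (`klBubbleMaj`, `klRungProfile`) with bodies; nothing about the model is asserted.  0 kit · 0 lit.
-/

noncomputable section

namespace Summit.HubbardSuperconductivity.HubbardSuperconductivity.Theorems.KLRegimeSplit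

set_option linter.dupNamespace false -- summit = problem name (single-conjunct summit), D-0017

open Real Finset Set Literature.MathematicalPhysics.QuantumLattice Literature.Probability.LatticeModels
open Summit.HubbardSuperconductivity.HubbardSuperconductivity.Theorems.DispersionFlow
open Summit.HubbardSuperconductivity.HubbardSuperconductivity.Theorems.KLProgrammeLegKernels
open Summit.HubbardSuperconductivity.HubbardSuperconductivity.Theorems.TwoPointAssembly
open Summit.HubbardSuperconductivity.HubbardSuperconductivity.Theorems.KLRegimeWick

/-! ## §1 Scale monotonicity, the torus diameter, the bubble majorant -/

section Maj

variable {L M : ℕ} [NeZero L] (β μ : ℝ) (K : TrigPolyC4v)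

omit [NeZero L] in
/-- The torus sup-distance never exceeds `π`. -/
theorem klTorusNorm_le_pi (q : TorusSite 2 L) : klTorusNorm L q ≤ π := by
  unfold klTorusNorm KLProgrammeLegKernels.torusSupNorm
  exact max_le (torusAbs_le_pi _) (torusAbs_le_pi _)

variable (L M) in
/-- **The termwise majorant of a pair bubble**: `klBubbleMaj a b Qm c = (βL²)⁻¹·Σ_ν (|a(ν,c)|‖ĝ_K(ν,c)‖)·(|b(ν̄, Qm−c)|‖ĝ_K(ν̄, Qm−c)‖)` (`abs_klBubbleMass_le`: `|B(a,b)(Qm,c)| ≤` it). -/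
def klBubbleMaj (β μ : ℝ) (K : TrigPolyC4v) (a b : FreqMomentum L M → ℝ) (Qm c : TorusSite 2 L) : ℝ :=
  (β * (L : ℝ) ^ 2)⁻¹ * ∑ ν : MatsubaraIdx M,
    (|a (ν, c)| * ‖propCT L M β μ K (ν, c)‖) * (|b (ν.rev, Qm - c)| * ‖propCT L M β μ K (ν.rev, Qm - c)‖)

omit [NeZero L] in
/-- `|B(a,b)(Qm,c)| ≤ klBubbleMaj a b Qm c` (`0 < β`). -/
theorem abs_klBubbleMass_le_klBubbleMaj (hβ : 0 < β) (a b : FreqMomentum L M → ℝ) (Qm c : TorusSite 2 L) :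
    |klBubbleMass L M β μ K a b Qm c| ≤ klBubbleMaj L M β μ K a b Qm c :=
  abs_klBubbleMass_le β μ K hβ a b Qm c

omit [NeZero L] in
/-- The majorant is nonnegative (`0 < β`). -/
theorem klBubbleMaj_nonneg (hβ : 0 < β) (a b : FreqMomentum L M → ℝ) (Qm c : TorusSite 2 L) : 0 ≤ klBubbleMaj L M β μ K a b Qm c := by
  unfold klBubbleMaj
  have hc : 0 ≤ (β * (L : ℝ) ^ 2)⁻¹ := by positivity
  exact mul_nonneg hc (sum_nonneg fun ν _ => mul_nonneg (mul_nonneg (abs_nonneg _) (norm_nonneg _)) (mul_nonneg (abs_nonneg _) (norm_nonneg _)))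

omit [NeZero L] in
/-- The majorant is monotone in the absolute values of both symbols (`0 < β`). -/
theorem klBubbleMaj_mono (hβ : 0 < β) {a a' b b' : FreqMomentum L M → ℝ} (ha : ∀ k, |a k| ≤ |a' k|) (hb : ∀ k, |b k| ≤ |b' k|) (Qm c : TorusSite 2 L) :
    klBubbleMaj L M β μ K a b Qm c ≤ klBubbleMaj L M β μ K a' b' Qm c := by
  unfold klBubbleMaj
  have hc : 0 ≤ (β * (L : ℝ) ^ 2)⁻¹ := by positivity
  refine mul_le_mul_of_nonneg_left (sum_le_sum fun ν _ => ?_) hc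
  exact mul_le_mul (mul_le_mul_of_nonneg_right (ha _) (norm_nonneg _)) (mul_le_mul_of_nonneg_right (hb _) (norm_nonneg _))
    (mul_nonneg (abs_nonneg _) (norm_nonneg _)) (mul_nonneg (abs_nonneg _) (norm_nonneg _))

/-- **Windowed sum of the majorant, hard LEFT line**: `|a|‖ĝ‖ ≤ A` ⇒ `Σ_{c : |c − x|_𝕋 ≤ ρ} Maj(a,b)(Qm,c) ≤ (βL²)⁻¹·A·Σ_{k : |k⃗ − (Qm − x)|_𝕋 ≤ ρ} |b(k)|‖ĝ(k)‖`. -/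
theorem sum_window_klBubbleMaj_le_of_left (hβ : 0 < β) {a : FreqMomentum L M → ℝ} (b : FreqMomentum L M → ℝ) {A : ℝ}
    (hA : ∀ k, |a k| * ‖propCT L M β μ K k‖ ≤ A) (Qm x : TorusSite 2 L) (ρ : ℝ) :
    ∑ c ∈ (univ : Finset (TorusSite 2 L)).filter (fun c => klTorusNorm L (c - x) ≤ ρ), klBubbleMaj L M β μ K a b Qm c ≤
      (β * (L : ℝ) ^ 2)⁻¹ * A *
        ∑ k ∈ (univ : Finset (FreqMomentum L M)).filter (fun k => klTorusNorm L (k.2 - (Qm - x)) ≤ ρ), |b k| * ‖propCT L M β μ K k‖ := by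
  classical
  have hc : 0 ≤ (β * (L : ℝ) ^ 2)⁻¹ := by positivity
  set soft : FreqMomentum L M → ℝ := fun k => |b k| * ‖propCT L M β μ K k‖ with hsoft
  have hsoft0 : ∀ k, 0 ≤ soft k := fun k => mul_nonneg (abs_nonneg _) (norm_nonneg _)
  have hwin : ∀ p : TorusSite 2 L, klTorusNorm L (p - x) = klTorusNorm L ((Qm - p) - (Qm - x)) := fun p => by
    rw [show Qm - p - (Qm - x) = x - p by abel, klvr_klTorusNorm_sub_comm]
  have hreindex : ∑ p : TorusSite 2 L, (if klTorusNorm L (p - x) ≤ ρ then ∑ ν : MatsubaraIdx M, soft (ν.rev, Qm - p) else 0) =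
      ∑ k ∈ (univ : Finset (FreqMomentum L M)).filter (fun k => klTorusNorm L (k.2 - (Qm - x)) ≤ ρ), soft k := by
    have h1 : ∀ p : TorusSite 2 L, ∑ ν : MatsubaraIdx M, soft (ν.rev, Qm - p) = ∑ ν : MatsubaraIdx M, soft (ν, Qm - p) := fun p =>
      Equiv.sum_comp Fin.revPerm (fun ν => soft (ν, Qm - p))
    simp_rw [h1, hwin]
    have h2 : ∑ p : TorusSite 2 L, (if klTorusNorm L ((Qm - p) - (Qm - x)) ≤ ρ then ∑ ν : MatsubaraIdx M, soft (ν, Qm - p) else 0) =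
        ∑ q : TorusSite 2 L, (if klTorusNorm L (q - (Qm - x)) ≤ ρ then ∑ ν : MatsubaraIdx M, soft (ν, q) else 0) :=
      Fintype.sum_equiv (Equiv.subLeft Qm) _ _ fun p => rfl
    rw [h2, Finset.sum_filter, Fintype.sum_prod_type, Finset.sum_comm]
    refine Finset.sum_congr rfl fun q _ => ?_
    split_ifs with h
    · rfl
    · simp
  rw [Finset.sum_filter]
  calc ∑ p, (if klTorusNorm L (p - x) ≤ ρ then klBubbleMaj L M β μ K a b Qm p else 0)
      ≤ ∑ p, (if klTorusNorm L (p - x) ≤ ρ then (β * (L : ℝ) ^ 2)⁻¹ * (A * ∑ ν : MatsubaraIdx M, soft (ν.rev, Qm - p)) else 0) := by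
        refine sum_le_sum fun p _ => ?_
        split_ifs with h
        · unfold klBubbleMaj
          refine mul_le_mul_of_nonneg_left ?_ hc
          rw [Finset.mul_sum]
          exact sum_le_sum fun ν _ => mul_le_mul_of_nonneg_right (hA _) (hsoft0 _)
        · exact le_rfl
    _ = (β * (L : ℝ) ^ 2)⁻¹ * A * ∑ p, (if klTorusNorm L (p - x) ≤ ρ then ∑ ν : MatsubaraIdx M, soft (ν.rev, Qm - p) else 0) := by
        rw [Finset.mul_sum]
        refine Finset.sum_congr rfl fun p _ => ?_
        split_ifs <;> ring
    _ = (β * (L : ℝ) ^ 2)⁻¹ * A *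
          ∑ k ∈ (univ : Finset (FreqMomentum L M)).filter (fun k => klTorusNorm L (k.2 - (Qm - x)) ≤ ρ), soft k := by rw [hreindex]

/-- **Windowed sum of the majorant, hard RIGHT line**: `|b|‖ĝ‖ ≤ A` ⇒ `Σ_{c : |c − x|_𝕋 ≤ ρ} Maj(a,b)(Qm,c) ≤ (βL²)⁻¹·A·Σ_{k : |k⃗ − x|_𝕋 ≤ ρ} |a(k)|‖ĝ(k)‖`. -/
theorem sum_window_klBubbleMaj_le_of_right (hβ : 0 < β) (a : FreqMomentum L M → ℝ) {b : FreqMomentum L M → ℝ} {A : ℝ}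
    (hA : ∀ k, |b k| * ‖propCT L M β μ K k‖ ≤ A) (Qm x : TorusSite 2 L) (ρ : ℝ) :
    ∑ c ∈ (univ : Finset (TorusSite 2 L)).filter (fun c => klTorusNorm L (c - x) ≤ ρ), klBubbleMaj L M β μ K a b Qm c ≤
      (β * (L : ℝ) ^ 2)⁻¹ * A *
        ∑ k ∈ (univ : Finset (FreqMomentum L M)).filter (fun k => klTorusNorm L (k.2 - x) ≤ ρ), |a k| * ‖propCT L M β μ K k‖ := by
  classical
  have hc : 0 ≤ (β * (L : ℝ) ^ 2)⁻¹ := by positivity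
  set soft : FreqMomentum L M → ℝ := fun k => |a k| * ‖propCT L M β μ K k‖ with hsoft
  have hsoft0 : ∀ k, 0 ≤ soft k := fun k => mul_nonneg (abs_nonneg _) (norm_nonneg _)
  have hplain : ∑ p : TorusSite 2 L, (if klTorusNorm L (p - x) ≤ ρ then ∑ ν : MatsubaraIdx M, soft (ν, p) else 0) =
      ∑ k ∈ (univ : Finset (FreqMomentum L M)).filter (fun k => klTorusNorm L (k.2 - x) ≤ ρ), soft k := by
    rw [Finset.sum_filter, Fintype.sum_prod_type, Finset.sum_comm]
    refine Finset.sum_congr rfl fun q _ => ?_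
    split_ifs with h
    · rfl
    · simp
  rw [Finset.sum_filter]
  calc ∑ p, (if klTorusNorm L (p - x) ≤ ρ then klBubbleMaj L M β μ K a b Qm p else 0)
      ≤ ∑ p, (if klTorusNorm L (p - x) ≤ ρ then (β * (L : ℝ) ^ 2)⁻¹ * (A * ∑ ν : MatsubaraIdx M, soft (ν, p)) else 0) := by
        refine sum_le_sum fun p _ => ?_
        split_ifs with h
        · unfold klBubbleMaj
          refine mul_le_mul_of_nonneg_left ?_ hc
          rw [Finset.mul_sum]
          exact sum_le_sum fun ν _ => (mul_le_mul_of_nonneg_left (hA _) (hsoft0 _)).trans (le_of_eq (mul_comm _ _))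
        · exact le_rfl
    _ = (β * (L : ℝ) ^ 2)⁻¹ * A * ∑ p, (if klTorusNorm L (p - x) ≤ ρ then ∑ ν : MatsubaraIdx M, soft (ν, p) else 0) := by
        rw [Finset.mul_sum]
        refine Finset.sum_congr rfl fun p _ => ?_
        split_ifs <;> ring
    _ = (β * (L : ℝ) ^ 2)⁻¹ * A *
          ∑ k ∈ (univ : Finset (FreqMomentum L M)).filter (fun k => klTorusNorm L (k.2 - x) ≤ ρ), soft k := by rw [hplain]

end Maj

/-! ## §2 The rung profile and its `t`-uniform domination of the rung increments -/

section Profile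

variable (L M : ℕ) [NeZero L]

/-- **The rung profile of the member with symbol `ψ` at scale `n+1`, frame `K`**: with `s = s^K_{n,n+1}` and `φ₀ = ψ + s` (the history member's symbol),
`klRungProfile β μ K n ψ Qm c := Maj(s, φ₀) + Maj(φ₀, s) + Maj(s, s)` — a `t`-uniform majorant of `|b(t,c) − b(0,c)|` for the rung curve `b(t) = −B(φ_t, φ_t)`,
`φ_t = ψ + (w_{Λ_{n+1}} − w_{Λ(t)})`, `Λ(t) = Λₙ + t(Λ_{n+1} − Λₙ)` (`norm_rung_sub_rung_zero_le_klRungProfile`). -/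
def klRungProfile (β μ : ℝ) (K : TrigPolyC4v) (n : ℕ) (ψ : FreqMomentum L M → ℝ) (Qm c : TorusSite 2 L) : ℝ :=
  klBubbleMaj L M β μ K (softSymbolCompl L M β μ K n (n + 1)) (fun k => ψ k + softSymbolCompl L M β μ K n (n + 1) k) Qm c +
    klBubbleMaj L M β μ K (fun k => ψ k + softSymbolCompl L M β μ K n (n + 1) k) (softSymbolCompl L M β μ K n (n + 1)) Qm c +
    klBubbleMaj L M β μ K (softSymbolCompl L M β μ K n (n + 1)) (softSymbolCompl L M β μ K n (n + 1)) Qm c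

variable {L M} (β μ : ℝ) (K : TrigPolyC4v)

omit [NeZero L] in
/-- The rung profile is nonnegative (`0 < β`). -/
theorem klRungProfile_nonneg (hβ : 0 < β) (n : ℕ) (ψ : FreqMomentum L M → ℝ) (Qm c : TorusSite 2 L) : 0 ≤ klRungProfile L M β μ K n ψ Qm c := by
  unfold klRungProfile
  have h1 := klBubbleMaj_nonneg β μ K hβ (softSymbolCompl L M β μ K n (n + 1)) (fun k => ψ k + softSymbolCompl L M β μ K n (n + 1) k) Qm c
  have h2 := klBubbleMaj_nonneg β μ K hβ (fun k => ψ k + softSymbolCompl L M β μ K n (n + 1) k) (softSymbolCompl L M β μ K n (n + 1)) Qm c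
  have h3 := klBubbleMaj_nonneg β μ K hβ (softSymbolCompl L M β μ K n (n + 1)) (softSymbolCompl L M β μ K n (n + 1)) Qm c
  linarith

omit [NeZero L] in
/-- The running slice part is dominated by the slice symbol: for `t ∈ [0,1]`, `0 ≤ w_{Λ(t)} − w_{Λₙ} ≤ s^K_{n,n+1}` (`Λ_{n+1} ≤ Λ(t) ≤ Λₙ`). -/
theorem runningSlice_mem (n : ℕ) {t : ℝ} (ht : t ∈ Icc (0 : ℝ) 1) (k : FreqMomentum L M) :
    0 ≤ hubbardCutoffWeightCT L M β μ K (klScale klE0 n + t * (klScale klE0 (n + 1) - klScale klE0 n)) k - hubbardCutoffWeightCT L M β μ K (klScale klE0 n) k ∧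
      hubbardCutoffWeightCT L M β μ K (klScale klE0 n + t * (klScale klE0 (n + 1) - klScale klE0 n)) k - hubbardCutoffWeightCT L M β μ K (klScale klE0 n) k ≤
        softSymbolCompl L M β μ K n (n + 1) k := by
  have hΛn : 0 < klScale klE0 n := klth_klScale_pos n
  have hΛn1 : 0 < klScale klE0 (n + 1) := klth_klScale_pos (n + 1)
  have hsucc : klScale klE0 (n + 1) = klScale klE0 n / 4 := klth_klScale_succ n
  set Λt := klScale klE0 n + t * (klScale klE0 (n + 1) - klScale klE0 n) with hΛt
  have hlo : klScale klE0 (n + 1) ≤ Λt := by rw [hΛt, hsucc]; nlinarith [ht.1, ht.2]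
  have hhi : Λt ≤ klScale klE0 n := by rw [hΛt, hsucc]; nlinarith [ht.1, ht.2]
  have h1 := klws_cutoffWeight_anti_scale L M β μ K (hΛn1.trans_le hlo) hhi k
  have h2 := klws_cutoffWeight_anti_scale L M β μ K hΛn1 hlo k
  unfold softSymbolCompl
  constructor <;> linarith

omit [NeZero L] in
/-- **The rung increment is dominated by the rung profile, uniformly on `[0,1]`**: with `φ_t = ψ + (w_{Λ_{n+1}} − w_{Λ(t)})`,
`‖(−B(φ_t,φ_t)(Qm,c)) − (−B(φ_0,φ_0)(Qm,c))‖ ≤ klRungProfile … n ψ Qm c` (`0 < β`). -/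
theorem norm_rung_sub_rung_zero_le_klRungProfile (hβ : 0 < β) (n : ℕ) (ψ : FreqMomentum L M → ℝ) (Qm c : TorusSite 2 L) {t : ℝ}
    (ht : t ∈ Icc (0 : ℝ) 1) :
    ‖(-((klBubbleMass L M β μ K
          (fun k => ψ k + (hubbardCutoffWeightCT L M β μ K (klScale klE0 (n + 1)) k -
            hubbardCutoffWeightCT L M β μ K (klScale klE0 n + t * (klScale klE0 (n + 1) - klScale klE0 n)) k))
          (fun k => ψ k + (hubbardCutoffWeightCT L M β μ K (klScale klE0 (n + 1)) k -
            hubbardCutoffWeightCT L M β μ K (klScale klE0 n + t * (klScale klE0 (n + 1) - klScale klE0 n)) k)) Qm c : ℝ) : ℂ)) -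
      (-((klBubbleMass L M β μ K
          (fun k => ψ k + (hubbardCutoffWeightCT L M β μ K (klScale klE0 (n + 1)) k -
            hubbardCutoffWeightCT L M β μ K (klScale klE0 n + 0 * (klScale klE0 (n + 1) - klScale klE0 n)) k))
          (fun k => ψ k + (hubbardCutoffWeightCT L M β μ K (klScale klE0 (n + 1)) k -
            hubbardCutoffWeightCT L M β μ K (klScale klE0 n + 0 * (klScale klE0 (n + 1) - klScale klE0 n)) k)) Qm c : ℝ) : ℂ))‖ ≤
      klRungProfile L M β μ K n ψ Qm c := by
  -- names
  set s : FreqMomentum L M → ℝ := softSymbolCompl L M β μ K n (n + 1) with hs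
  set φ₀ : FreqMomentum L M → ℝ := fun k => ψ k + softSymbolCompl L M β μ K n (n + 1) k with hφ₀
  set δ : FreqMomentum L M → ℝ := fun k => -(hubbardCutoffWeightCT L M β μ K (klScale klE0 n + t * (klScale klE0 (n + 1) - klScale klE0 n)) k -
    hubbardCutoffWeightCT L M β μ K (klScale klE0 n) k) with hδ
  -- the running symbol is `φ₀ + δ`, the initial one is `φ₀`
  have hφt : (fun k => ψ k + (hubbardCutoffWeightCT L M β μ K (klScale klE0 (n + 1)) k -
      hubbardCutoffWeightCT L M β μ K (klScale klE0 n + t * (klScale klE0 (n + 1) - klScale klE0 n)) k)) = φ₀ + δ := by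
    funext k; simp only [hφ₀, hδ, softSymbolCompl, Pi.add_apply]; ring
  have hφ0 : (fun k => ψ k + (hubbardCutoffWeightCT L M β μ K (klScale klE0 (n + 1)) k -
      hubbardCutoffWeightCT L M β μ K (klScale klE0 n + 0 * (klScale klE0 (n + 1) - klScale klE0 n)) k)) = φ₀ := by
    funext k; simp only [hφ₀, softSymbolCompl, zero_mul, add_zero]
  rw [hφt, hφ0]
  -- bilinear expansion
  have hexp : klBubbleMass L M β μ K (φ₀ + δ) (φ₀ + δ) Qm c - klBubbleMass L M β μ K φ₀ φ₀ Qm c =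
      klBubbleMass L M β μ K δ φ₀ Qm c + klBubbleMass L M β μ K φ₀ δ Qm c + klBubbleMass L M β μ K δ δ Qm c := by
    rw [klBubbleMass_add_left, klBubbleMass_add_right, klBubbleMass_add_right]; ring
  have hnorm : ‖(-((klBubbleMass L M β μ K (φ₀ + δ) (φ₀ + δ) Qm c : ℝ) : ℂ)) - (-((klBubbleMass L M β μ K φ₀ φ₀ Qm c : ℝ) : ℂ))‖ =
      |klBubbleMass L M β μ K δ φ₀ Qm c + klBubbleMass L M β μ K φ₀ δ Qm c + klBubbleMass L M β μ K δ δ Qm c| := by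
    rw [← hexp, show (-((klBubbleMass L M β μ K (φ₀ + δ) (φ₀ + δ) Qm c : ℝ) : ℂ)) - (-((klBubbleMass L M β μ K φ₀ φ₀ Qm c : ℝ) : ℂ)) =
      -(((klBubbleMass L M β μ K (φ₀ + δ) (φ₀ + δ) Qm c - klBubbleMass L M β μ K φ₀ φ₀ Qm c : ℝ) : ℂ)) by push_cast; ring,
      norm_neg, Complex.norm_real, Real.norm_eq_abs]
  rw [hnorm]
  -- `|δ| ≤ s = |s|`, `|φ₀| ≤ |φ₀|`
  have hδs : ∀ k, |δ k| ≤ |s k| := fun k => by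
    obtain ⟨h0, h1⟩ := runningSlice_mem (L := L) (M := M) β μ K n ht k
    rw [hδ, abs_neg, abs_of_nonneg h0]
    exact h1.trans (le_abs_self _)
  have hrefl : ∀ k, |φ₀ k| ≤ |φ₀ k| := fun _ => le_rfl
  have hsrefl : ∀ k, |s k| ≤ |s k| := fun _ => le_rfl
  have b1 := (abs_klBubbleMass_le_klBubbleMaj β μ K hβ δ φ₀ Qm c).trans (klBubbleMaj_mono β μ K hβ hδs hrefl Qm c)
  have b2 := (abs_klBubbleMass_le_klBubbleMaj β μ K hβ φ₀ δ Qm c).trans (klBubbleMaj_mono β μ K hβ hrefl hδs Qm c)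
  have b3 := (abs_klBubbleMass_le_klBubbleMaj β μ K hβ δ δ Qm c).trans (klBubbleMaj_mono β μ K hβ hδs hδs Qm c)
  unfold klRungProfile
  refine (abs_add_le _ _).trans ((add_le_add (abs_add_le _ _) le_rfl).trans ?_)
  rw [← hs, ← hφ₀]
  linarith

end Profile

/-! ## §3 Total and windowed masses of the rung profile on admissible frames -/

section Masses

variable {L M : ℕ} [NeZero L] (β μ : ℝ) (K : TrigPolyC4v) {R : RenConsts} {U : ℝ} {N : ℕ}

/-- **WINDOWED MASS of the rung profile**: on an admissible frame, `klBetaMin ≤ β ≤ L`, history symbol admissible at `n` (`0 ≤ ψ + s ≤ 1 − w^K_{Λₙ}`), every `Qm`, centre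
`x`, radius `ρ ≥ 0`: `Σ_{c : |c − x|_𝕋 ≤ ρ} klRungProfile … n ψ Qm c ≤ 369144·(ρ/π + 1/L)` (`369144 = 3·8·15381`: hard line `s‖ĝ‖ ≤ 2/Λ_{n+1} = 8/Λₙ`, the three
soft partners windowed by `sum_window_softSymbol_mul_norm_propCT_le`). -/
theorem sum_window_klRungProfile_le (hK : FrameOK R U N μ K) (hβ : klBetaMin ≤ β) (hβL : β ≤ L) (n : ℕ) {ψ : FreqMomentum L M → ℝ}
    (hφ₀ : ∀ k, 0 ≤ ψ k + softSymbolCompl L M β μ K n (n + 1) k ∧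
      ψ k + softSymbolCompl L M β μ K n (n + 1) k ≤ 1 - hubbardCutoffWeightCT L M β μ K (klScale klE0 n) k)
    (Qm x : TorusSite 2 L) {ρ : ℝ} (hρ : 0 ≤ ρ) :
    ∑ c ∈ (univ : Finset (TorusSite 2 L)).filter (fun c => klTorusNorm L (c - x) ≤ ρ), klRungProfile L M β μ K n ψ Qm c ≤
      369144 * (ρ / π + ((L : ℝ))⁻¹) := by
  have hβ0 : 0 < β := pos_of_klBetaMin_le hβ
  have hΛ : 0 < klScale klE0 n := klth_klScale_pos n
  have hL : (0 : ℝ) < L := lt_of_lt_of_le hβ0 hβL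
  have hπ := Real.pi_pos
  -- the slice symbol: hard at `n+1`, soft at `n`
  have hA := softSymbolCompl_succ_mul_norm_propCT_le (L := L) (M := M) β μ K n
  have hs : ∀ k, 0 ≤ softSymbolCompl L M β μ K n (n + 1) k ∧ softSymbolCompl L M β μ K n (n + 1) k ≤ 1 - hubbardCutoffWeightCT L M β μ K (klScale klE0 n) k :=
    (isSoftSymbol_compl (L := L) (M := M) β μ K (Nat.le_succ n)).1
  have hsucc : klScale klE0 (n + 1) = klScale klE0 n / 4 := klth_klScale_succ n
  have hc : 0 ≤ (β * (L : ℝ) ^ 2)⁻¹ * (2 / klScale klE0 (n + 1)) := by have := klth_klScale_pos (n + 1); positivity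
  -- the three terms
  have h1 := sum_window_klBubbleMaj_le_of_left β μ K hβ0 (fun k => ψ k + softSymbolCompl L M β μ K n (n + 1) k) hA Qm x ρ
  have h2 := sum_window_klBubbleMaj_le_of_right β μ K hβ0 (fun k => ψ k + softSymbolCompl L M β μ K n (n + 1) k) hA Qm x ρ
  have h3 := sum_window_klBubbleMaj_le_of_left β μ K hβ0 (softSymbolCompl L M β μ K n (n + 1)) hA Qm x ρ
  have s1 := sum_window_softSymbol_mul_norm_propCT_le β μ K hK hβ hβL n hφ₀ (Qm - x) hρ
  have s2 := sum_window_softSymbol_mul_norm_propCT_le β μ K hK hβ hβL n hφ₀ x hρ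
  have s3 := sum_window_softSymbol_mul_norm_propCT_le β μ K hK hβ hβL n hs (Qm - x) hρ
  unfold klRungProfile
  rw [sum_add_distrib, sum_add_distrib]
  have e : (β * (L : ℝ) ^ 2)⁻¹ * (2 / klScale klE0 (n + 1)) * (15381 * (ρ / π + ((L : ℝ))⁻¹) * klScale klE0 n * β * (L : ℝ) ^ 2) =
      123048 * (ρ / π + ((L : ℝ))⁻¹) := by
    rw [hsucc]; field_simp; ring
  have t1 := (h1.trans (mul_le_mul_of_nonneg_left s1 hc)).trans (le_of_eq e)
  have t2 := (h2.trans (mul_le_mul_of_nonneg_left s2 hc)).trans (le_of_eq e)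
  have t3 := (h3.trans (mul_le_mul_of_nonneg_left s3 hc)).trans (le_of_eq e)
  linarith

/-- **TOTAL MASS of the rung profile** (the window `ρ = π` is everything): `Σ_c klRungProfile … n ψ Qm c ≤ 369144·(1 + 1/L) ≤ 738288`. -/
theorem sum_klRungProfile_le (hK : FrameOK R U N μ K) (hβ : klBetaMin ≤ β) (hβL : β ≤ L) (n : ℕ) {ψ : FreqMomentum L M → ℝ}
    (hφ₀ : ∀ k, 0 ≤ ψ k + softSymbolCompl L M β μ K n (n + 1) k ∧
      ψ k + softSymbolCompl L M β μ K n (n + 1) k ≤ 1 - hubbardCutoffWeightCT L M β μ K (klScale klE0 n) k)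
    (Qm : TorusSite 2 L) : ∑ c, klRungProfile L M β μ K n ψ Qm c ≤ 738288 := by
  have hβ0 : 0 < β := pos_of_klBetaMin_le hβ
  have hL : (0 : ℝ) < L := lt_of_lt_of_le hβ0 hβL
  have hL1 : (1 : ℝ) ≤ L := by exact_mod_cast Nat.one_le_iff_ne_zero.mpr (NeZero.ne L)
  have hπ := Real.pi_pos
  have h := sum_window_klRungProfile_le β μ K hK hβ hβL n hφ₀ Qm 0 Real.pi_pos.le
  have hall : ((univ : Finset (TorusSite 2 L)).filter fun c => klTorusNorm L (c - 0) ≤ π) = (univ : Finset (TorusSite 2 L)) := by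
    refine Finset.filter_true_of_mem fun c _ => ?_
    exact klTorusNorm_le_pi (c - 0)
  rw [hall] at h
  have hinv : ((L : ℝ))⁻¹ ≤ 1 := inv_le_one_of_one_le₀ hL1
  have hππ : π / π = 1 := div_self hπ.ne'
  rw [hππ] at h
  linarith

/-- The `A·η` shape for the door's layer cake (`π/L ≤ η`): `Σ_{c : |c − x|_𝕋 ≤ η} klRungProfile … c ≤ (2·369144/π)·η`. -/
theorem sum_window_klRungProfile_le_linear (hK : FrameOK R U N μ K) (hβ : klBetaMin ≤ β) (hβL : β ≤ L) (n : ℕ) {ψ : FreqMomentum L M → ℝ}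
    (hφ₀ : ∀ k, 0 ≤ ψ k + softSymbolCompl L M β μ K n (n + 1) k ∧
      ψ k + softSymbolCompl L M β μ K n (n + 1) k ≤ 1 - hubbardCutoffWeightCT L M β μ K (klScale klE0 n) k)
    (Qm x : TorusSite 2 L) {η : ℝ} (hη : Real.pi / L ≤ η) :
    ∑ c ∈ (univ : Finset (TorusSite 2 L)).filter (fun c => klTorusNorm L (c - x) ≤ η), klRungProfile L M β μ K n ψ Qm c ≤ 2 * 369144 / π * η := by
  have hL : (0 : ℝ) < L := Nat.cast_pos.2 (Nat.pos_of_ne_zero (NeZero.ne L))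
  have hπ := Real.pi_pos
  have hη0 : 0 ≤ η := le_trans (by positivity) hη
  refine (sum_window_klRungProfile_le β μ K hK hβ hβL n hφ₀ Qm x hη0).trans ?_
  have hinv : ((L : ℝ))⁻¹ ≤ η / π := by
    rw [inv_eq_one_div, div_le_div_iff₀ hL hπ]
    rw [div_le_iff₀ hL] at hη
    linarith
  have : 369144 * (η / π + ((L : ℝ))⁻¹) ≤ 369144 * (η / π + η / π) := by gcongr
  refine this.trans (le_of_eq ?_)
  field_simp
  ring

/-- **INDEX FORM** (the member `ψ = s^K_{n+1,j}`, `n+1 ≤ j`: its history symbol is `s^K_{n,j}`, admissible at `n`): windowed mass `≤ 369144·(ρ/π + 1/L)`. -/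
theorem sum_window_klRungProfile_compl_le (hK : FrameOK R U N μ K) (hβ : klBetaMin ≤ β) (hβL : β ≤ L) {n j : ℕ} (hj : n + 1 ≤ j)
    (Qm x : TorusSite 2 L) {ρ : ℝ} (hρ : 0 ≤ ρ) :
    ∑ c ∈ (univ : Finset (TorusSite 2 L)).filter (fun c => klTorusNorm L (c - x) ≤ ρ),
        klRungProfile L M β μ K n (softSymbolCompl L M β μ K (n + 1) j) Qm c ≤ 369144 * (ρ / π + ((L : ℝ))⁻¹) := by
  refine sum_window_klRungProfile_le β μ K hK hβ hβL n (fun k => ?_) Qm x hρ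
  have h := (isSoftSymbol_compl (L := L) (M := M) β μ K ((Nat.le_succ n).trans hj)).1 k
  rw [softSymbolCompl_succ_add_slice_apply β μ K n j k]
  exact h

/-- Index form, total mass: `Σ_c klRungProfile … n (s_{n+1,j}) Qm c ≤ 738288` (`n+1 ≤ j`). -/
theorem sum_klRungProfile_compl_le (hK : FrameOK R U N μ K) (hβ : klBetaMin ≤ β) (hβL : β ≤ L) {n j : ℕ} (hj : n + 1 ≤ j) (Qm : TorusSite 2 L) :
    ∑ c, klRungProfile L M β μ K n (softSymbolCompl L M β μ K (n + 1) j) Qm c ≤ 738288 := by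
  refine sum_klRungProfile_le β μ K hK hβ hβL n (fun k => ?_) Qm
  have h := (isSoftSymbol_compl (L := L) (M := M) β μ K ((Nat.le_succ n).trans hj)).1 k
  rw [softSymbolCompl_succ_add_slice_apply β μ K n j k]
  exact h

/-- Index form, `A·η` shape (`π/L ≤ η`): `Σ_{c : |c − x|_𝕋 ≤ η} klRungProfile … n (s_{n+1,j}) Qm c ≤ (2·369144/π)·η` (`n+1 ≤ j`). -/
theorem sum_window_klRungProfile_compl_le_linear (hK : FrameOK R U N μ K) (hβ : klBetaMin ≤ β) (hβL : β ≤ L) {n j : ℕ} (hj : n + 1 ≤ j)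
    (Qm x : TorusSite 2 L) {η : ℝ} (hη : Real.pi / L ≤ η) :
    ∑ c ∈ (univ : Finset (TorusSite 2 L)).filter (fun c => klTorusNorm L (c - x) ≤ η),
        klRungProfile L M β μ K n (softSymbolCompl L M β μ K (n + 1) j) Qm c ≤ 2 * 369144 / π * η := by
  refine sum_window_klRungProfile_le_linear β μ K hK hβ hβL n (fun k => ?_) Qm x hη
  have h := (isSoftSymbol_compl (L := L) (M := M) β μ K ((Nat.le_succ n).trans hj)).1 k
  rw [softSymbolCompl_succ_add_slice_apply β μ K n j k]
  exact h

end Masses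

end Summit.HubbardSuperconductivity.HubbardSuperconductivity.Theorems.KLRegimeSplit

end
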